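import Mathlib
import HarnessLib

/-!
# Route `LeeYangFibres`, crux `PrimeCellsRelative` (stmt-Parity-14112), line `SketchIdeator4`
# (card `sieve-out-to-chowla`): the pure real budget of the stub `stub_chowlaClipsParity`

Helper file 1 of the registered stub `stub_chowlaClipsParity` (the constant schedule of the line):
the two real-variable inequalities into which the per-scale argument is funnelled.  Notation at one
scale `N` (`ℓ = log N ≥ 1`) and roughness `u`: mass `M = β_∞ ∏_p β_p ≥ 0`, rough densities
`a_m = A_m(N)/N ≥ 0`, `a₁ = a_1`, `Â = Σ_{m ≤ u} a_m ≥ c u/ℓ`, `Ã = |Σ_m (−1)^m a_m| ≤ ε_M Â`,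
law error `E = ε_law N/ℓ^t`, junk `J`.

* `perSet_bound` (registered sub-goal) — for one non-empty `S ⊆ [t]`: the Walsh extraction
  `|θ_S| M Â^t ≤ |E_S| + 2^{t+1} Ã Â^{t-1} M + u^t E` and the sieve transfer
  `|E_S| ≤ X M (u/ℓ)^t + J` (`X = C e^{-s} ≤ δ c^t`) give
  `|θ_S| M a₁^t ≤ (δ + 2^{t+1} ε_M) M a₁^t + J + (2/c)^t E`
  (multiply by `a₁^t`, compare with `Â^t` termwise: `c u a₁/ℓ ≤ Â a₁`, `Ã ≤ ε_M Â`, `u a₁ ≤ 2Â/c`);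
* `final_budget` (registered sub-goal) — with `δ = ε/2^{t+2}`, `ε_M = δ/2^{t+1}`,
  `ε_law = ε/(2^{t+2}((2/c)^t + 1))`, `J ≤ δ N/ℓ^t` and the `2^t − 1 ≤ 2^t` non-empty `S`:
  `E + (Σ_{S ≠ ∅} |θ_S|) M a₁^t ≤ ε (M a₁^t + N/ℓ^t)` (`2^{t+1} δ = ε/2`, three terms `≤ ε/4 · N/ℓ^t`).

Elementary (ordered-field arithmetic); no number theory.
-/

noncomputable section

namespace Summit.Parity.GeneralizedHardyLittlewood.Cruxes.PrimeCellsRelative.SieveOutToChowla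

/-- **Per-set budget (the heart of the constant schedule).** From the Walsh extraction
`θ_S M Â^t ≤ E_S + 2^{t+1} Ã Â^{t-1} M + u^t E`, the sieve transfer `E_S ≤ X M (u/ℓ)^t + J`
(`X = C e^{-s} ≤ δ c^t`), the anatomy `Â ≥ c u/ℓ`, `a₁ ≤ min(Â, 2/ℓ)` and the balance `Ã ≤ ε_M Â`:
`θ_S M a₁^t ≤ (δ + 2^{t+1} ε_M) M a₁^t + J + (2/c)^t E` (multiply by `a₁^t` and compare with
`Â^t` termwise). [folklore] -/
theorem perSet_bound {t : ℕ} (ht : 1 ≤ t) {θS M Ah At a u ℓ c X E J ES δ εM : ℝ}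
    (hW : θS * M * Ah ^ t ≤ ES + 2 ^ (t + 1) * At * Ah ^ (t - 1) * M + u ^ t * E)
    (hES : ES ≤ X * M * (u / ℓ) ^ t + J)
    (hM : 0 ≤ M) (hc : 0 < c) (hA : c * u / ℓ ≤ Ah) (ha0 : 0 ≤ a) (ha1 : a ≤ Ah)
    (ha2 : a ≤ 2 / ℓ) (hℓ : 1 ≤ ℓ) (hu : 1 ≤ u) (hAt : At ≤ εM * Ah)
    (hJ : 0 ≤ J) (hE : 0 ≤ E) (hδ : 0 ≤ δ) (hX : X ≤ δ * c ^ t) :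
    θS * (M * a ^ t) ≤ (δ + 2 ^ (t + 1) * εM) * (M * a ^ t) + J + (2 / c) ^ t * E := by
  have hℓ0 : 0 < ℓ := by linarith
  have hu0 : 0 < u := by linarith
  have hAh : 0 < Ah := lt_of_lt_of_le (by positivity) hA
  have hAht : 0 < Ah ^ t := pow_pos hAh t
  have hat : 0 ≤ a ^ t := pow_nonneg ha0 t
  have hcu : c * u ≤ Ah * ℓ := (div_le_iff₀ hℓ0).mp hA
  have haℓ : a * ℓ ≤ 2 := (le_div_iff₀ hℓ0).mp ha2
  refine le_of_mul_le_mul_right ?_ hAht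
  have step : θS * (M * a ^ t) * Ah ^ t ≤
      (ES + 2 ^ (t + 1) * At * Ah ^ (t - 1) * M + u ^ t * E) * a ^ t := by
    calc θS * (M * a ^ t) * Ah ^ t = θS * M * Ah ^ t * a ^ t := by ring
      _ ≤ _ := mul_le_mul_of_nonneg_right hW hat
  have hES' : ES * a ^ t ≤ (X * M * (u / ℓ) ^ t + J) * a ^ t := mul_le_mul_of_nonneg_right hES hat
  -- the sieve main term
  have hT1 : X * M * (u / ℓ) ^ t * a ^ t ≤ δ * M * a ^ t * Ah ^ t := by
    have h1 : c * u * a / ℓ ≤ Ah * a := by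
      rw [div_le_iff₀ hℓ0]
      calc c * u * a = (c * u) * a := by ring
        _ ≤ (Ah * ℓ) * a := mul_le_mul_of_nonneg_right hcu ha0
        _ = Ah * a * ℓ := by ring
    have h2 : (c * u * a / ℓ) ^ t ≤ (Ah * a) ^ t := pow_le_pow_left₀ (by positivity) h1 t
    calc X * M * (u / ℓ) ^ t * a ^ t = X * (M * ((u / ℓ) ^ t * a ^ t)) := by ring
      _ ≤ δ * c ^ t * (M * ((u / ℓ) ^ t * a ^ t)) :=
          mul_le_mul_of_nonneg_right hX (by positivity)
      _ = δ * M * (c * u * a / ℓ) ^ t := by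
          rw [div_pow, div_pow, mul_pow, mul_pow]; ring
      _ ≤ δ * M * (Ah * a) ^ t := mul_le_mul_of_nonneg_left h2 (by positivity)
      _ = δ * M * a ^ t * Ah ^ t := by rw [mul_pow]; ring
  -- the junk
  have hTJ : J * a ^ t ≤ J * Ah ^ t := mul_le_mul_of_nonneg_left (pow_le_pow_left₀ ha0 ha1 t) hJ
  -- the alternating term
  have hT2 : 2 ^ (t + 1) * At * Ah ^ (t - 1) * M * a ^ t ≤
      2 ^ (t + 1) * εM * M * a ^ t * Ah ^ t := by
    have hpow : Ah * Ah ^ (t - 1) = Ah ^ t := mul_pow_sub_one (by omega) Ah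
    calc 2 ^ (t + 1) * At * Ah ^ (t - 1) * M * a ^ t
        = At * (2 ^ (t + 1) * Ah ^ (t - 1) * M * a ^ t) := by ring
      _ ≤ (εM * Ah) * (2 ^ (t + 1) * Ah ^ (t - 1) * M * a ^ t) :=
          mul_le_mul_of_nonneg_right hAt (by positivity)
      _ = 2 ^ (t + 1) * εM * M * a ^ t * (Ah * Ah ^ (t - 1)) := by ring
      _ = 2 ^ (t + 1) * εM * M * a ^ t * Ah ^ t := by rw [hpow]
  -- the law error
  have hT3 : u ^ t * E * a ^ t ≤ (2 / c) ^ t * E * Ah ^ t := by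
    have h1 : u * a ≤ 2 / c * Ah := by
      rw [div_mul_eq_mul_div, le_div_iff₀ hc]
      calc u * a * c = a * (c * u) := by ring
        _ ≤ a * (Ah * ℓ) := mul_le_mul_of_nonneg_left hcu ha0
        _ = Ah * (a * ℓ) := by ring
        _ ≤ Ah * 2 := mul_le_mul_of_nonneg_left haℓ hAh.le
        _ = 2 * Ah := by ring
    have h2 : (u * a) ^ t ≤ (2 / c * Ah) ^ t := pow_le_pow_left₀ (by positivity) h1 t
    calc u ^ t * E * a ^ t = E * (u * a) ^ t := by rw [mul_pow]; ring
      _ ≤ E * (2 / c * Ah) ^ t := mul_le_mul_of_nonneg_left h2 hE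
      _ = (2 / c) ^ t * E * Ah ^ t := by rw [mul_pow]; ring
  linarith [step, hES', hT1, hTJ, hT2, hT3]

/-- **Final budget.** With `δ = ε/2^{t+2}`, `ε_M = δ/2^{t+1}`, `ε_law = ε/(2^{t+2}((2/c)^t + 1))`,
`J ≤ δ P`, `E = ε_law P` and `Θ Q ≤ 2^t((δ + 2^{t+1}ε_M) Q + J + (2/c)^t E)`:
`E + Θ Q ≤ ε (Q + P)` (`2^{t+1} δ = ε/2`, and three terms `≤ ε P/4`). [folklore] -/
theorem final_budget {t : ℕ} {ε c Q P J E Θ δ εM εlaw : ℝ} (hε : 0 ≤ ε) (hc : 0 < c)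
    (hQ : 0 ≤ Q) (hP : 0 ≤ P) (hδ : δ = ε / 2 ^ (t + 2)) (hεM : εM = δ / 2 ^ (t + 1))
    (hεlaw : εlaw = ε / (2 ^ (t + 2) * ((2 / c) ^ t + 1))) (hJ : J ≤ δ * P) (hE : E = εlaw * P)
    (hΘ : Θ * Q ≤ 2 ^ t * ((δ + 2 ^ (t + 1) * εM) * Q + J + (2 / c) ^ t * E)) :
    E + Θ * Q ≤ ε * (Q + P) := by
  subst hE hεlaw hεM hδ
  set D := (2 / c) ^ t with hD
  have hD0 : 0 < D := by positivity
  have h2t : (0 : ℝ) < 2 ^ t := by positivity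
  have h2t' : (2 : ℝ) ^ t ≠ 0 := h2t.ne'
  have h4 : (2 : ℝ) ^ (t + 2) = 2 ^ t * 4 := by rw [pow_add]; norm_num
  have h2 : (2 : ℝ) ^ (t + 1) = 2 ^ t * 2 := by rw [pow_succ]
  have e1 : 2 ^ t * (ε / 2 ^ (t + 2) + 2 ^ (t + 1) * (ε / 2 ^ (t + 2) / 2 ^ (t + 1))) = ε / 2 := by
    rw [h4, h2]; field_simp; ring
  have e2 : 2 ^ t * (ε / 2 ^ (t + 2) * P) = ε / 4 * P := by
    rw [h4]; field_simp
  have e3 : 2 ^ t * (D * (ε / (2 ^ (t + 2) * (D + 1)) * P)) ≤ ε / 4 * P := by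
    have : 2 ^ t * (D * (ε / (2 ^ (t + 2) * (D + 1)) * P)) = ε / 4 * P * (D / (D + 1)) := by
      rw [h4]; field_simp
    rw [this]
    have hD1 : D / (D + 1) ≤ 1 := by rw [div_le_one (by linarith)]; linarith
    calc ε / 4 * P * (D / (D + 1)) ≤ ε / 4 * P * 1 :=
          mul_le_mul_of_nonneg_left hD1 (by positivity)
      _ = ε / 4 * P := mul_one _
  have e4 : ε / (2 ^ (t + 2) * (D + 1)) * P ≤ ε / 4 * P := by
    refine mul_le_mul_of_nonneg_right ?_ hP
    refine div_le_div_of_nonneg_left hε (by norm_num) ?_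
    have : (1 : ℝ) ≤ 2 ^ t := one_le_pow₀ (by norm_num)
    rw [h4]; nlinarith
  have hJ' : 2 ^ t * J ≤ ε / 4 * P := by
    rw [← e2]; exact mul_le_mul_of_nonneg_left hJ h2t.le
  have expand : 2 ^ t * ((ε / 2 ^ (t + 2) + 2 ^ (t + 1) * (ε / 2 ^ (t + 2) / 2 ^ (t + 1))) * Q + J +
      D * (ε / (2 ^ (t + 2) * (D + 1)) * P)) =
      2 ^ t * (ε / 2 ^ (t + 2) + 2 ^ (t + 1) * (ε / 2 ^ (t + 2) / 2 ^ (t + 1))) * Q + 2 ^ t * J +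
        2 ^ t * (D * (ε / (2 ^ (t + 2) * (D + 1)) * P)) := by ring
  rw [expand, e1] at hΘ
  nlinarith [hΘ, e3, e4, hJ', mul_nonneg hε hQ, mul_nonneg hε hP]

end Summit.Parity.GeneralizedHardyLittlewood.Cruxes.PrimeCellsRelative.SieveOutToChowla

end
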